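import Mathlib
import Summits.ValiantsHypothesis.ValiantsHypothesis.Theorems.NewtonUnitEquationsDissociatedUniformTotalsLawOneLap
import Summits.ValiantsHypothesis.ValiantsHypothesis.Theorems.NewtonUnitEquationsDissociatedUniformTotalsLawRigidPairs
import HarnessLib

/-!
# Crux `NewtonUnitEquations.DissociatedUniform` (stmt-ValiantsHypothesis-5905): the CO-ORIENTED POINTWISE LAW for a rigid pair —
# crossing number `3`, hence `V_s ≤ 4q` for ANY strictly convex counter-clockwise third polygon in the dominant regime

Memo `Cruxes/DissociatedUniform/NOTES-t1g8.md` §2 (pointwise dichotomy on the smooth stratum: a rigid pair `a, b` of sampled circles with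
a CONTRA-oriented fan third polygon holds `≈ q²/2` vertices in one class — kernel `…SmoothPointwise(13)`; co-oriented census `≤ 4q`,
typed `@[conjecture] CoOrientedClassBound`) and §5(i) (the recommended regular-pair sketch).  THIS FILE PROVES THE CO-ORIENTED SIDE for
rigid pairs with an ARBITRARY strictly convex ccw third polygon `c`:

* **`card_rot_hits_le_three`** (the crossing number): for `c` strictly convex ccw (`q ≥ 3`), a non-zero weight `n` and `u ∈ ℤ/q`,
  `#{x : c (u − 2x) is a weak top of C at R_{2πx/q} n} ≤ 3` — as `x` advances, the weight turns counter-clockwise ONE lap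
  (`…TotalsLawOneLap.exists_coneAngles`: monotone cone-index lift `i_x`, `i_{x'} ≤ i_x + q`) while the target vertex `u − 2x` recedes
  two laps, so `D_x = i_x + 2·val x` is strictly increasing, constant mod `q`, and spans `< 3q`: the quotients `D_x / q` of two hits differ
  by `1` or `2`, an injection into the residues mod `3`;
* **`card_commonDir_rigid_le : #{CommonDir} ≤ 4q`** for `a = trigCurve c₁ A φ`, `b = trigCurve c₂ B ψ` (`B² < A²`) and `c` strictly
  convex ccw (cone sweep count + shear re-indexing + unique exposing direction of `…TotalsLawRigidPairs`, then the crossing number);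
* **`classVert_rigid_smul_le : ∃ μ₀, ∀ μ ≥ μ₀, ∀ s, V_s(a, b, μ•c) ≤ 4q`** (`A² ≠ B²`; `…LargeThirdPointwise.classVert_smul_le_card_commonDir`)
  and **`totalVert_rigid_smul_le : T(a, b, μ•c) ≤ 4q²`**.
This is the positive half of the orientation dichotomy of NOTES-t1g8 §2 for rigid pairs — the located constant `4` of
`CoOrientedClassBound 4` is met, in the dominant regime, by every co-oriented strictly convex third polygon over a pair of sampled
circles; the contra-oriented fan over the same pairs breaks every constant (`…SmoothPointwise`).  `CoOrientedClassBound` itself (general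
co-oriented convexly ordered pairs, all regimes), `SmoothSharpTotalsLaw`, `TotalsLawThree` remain OPEN; nothing here bears on VP ≠ VNP.
[folklore]
-/

set_option linter.dupNamespace false -- `ValiantsHypothesis.ValiantsHypothesis` (summit = problem) in every name

open scoped BigOperators

namespace Summit.ValiantsHypothesis.ValiantsHypothesis.Theorems.NewtonUnitEquationsDissociatedUniform

namespace TotalsLaw

open Matrix Real

section CoOrientedRigid

variable {q : ℕ} [NeZero q]

open scoped Classical in
/-- **THE CROSSING NUMBER.**  For a strictly convex ccw polygon `c` (`q ≥ 3`), a non-zero weight `n` and `u ∈ ℤ/q`: at most THREE labels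
`x` have `c (u − 2x)` a weak top of `C` at the turned weight `R_{2πx/q} n`. [folklore] -/
theorem card_rot_hits_le_three {c : ZMod q → (Fin 2 → ℝ)} (hc : StrictlyConvexCcw c) (hq : 3 ≤ q) {n : Fin 2 → ℝ} (hn : n ≠ 0)
    (u : ZMod q) :
    (Finset.univ.filter fun x : ZMod q => WTop c (rot (2 * π * (x.val : ℝ) / q) n) (u - 2 * x)).card ≤ 3 := by
  obtain ⟨ω, hmono, hper, hlift⟩ := exists_coneAngles hc hq
  have hqpos : (0 : ℝ) < q := by exact_mod_cast (show 0 < q by omega)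
  have h2π : (0 : ℝ) < 2 * π := by positivity
  -- polar form of the weight, base angle in `[ω q, ω q + 2π)`
  obtain ⟨r, hr, t₁, hnt₁⟩ := exists_polar hn
  set t₀ := toIcoMod h2π (ω q) t₁ with ht₀
  have ht₀mem := toIcoMod_mem_Ico h2π (ω q) t₁
  rw [← ht₀] at ht₀mem
  obtain ⟨ht₀lo, ht₀hi⟩ := ht₀mem
  have hut : udir t₀ = udir t₁ := by
    have e := self_sub_toIcoMod h2π (ω q) t₁
    rw [zsmul_eq_mul, ← ht₀] at e
    rw [show t₀ = t₁ + ((-toIcoDiv h2π (ω q) t₁ : ℤ) : ℝ) * (2 * π) by push_cast; linarith, udir_add_int_mul]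
  -- the turned weights in polar form
  set T : ZMod q → ℝ := fun x => t₀ + 2 * π * (x.val : ℝ) / q with hT
  have hrot : ∀ x : ZMod q, rot (2 * π * (x.val : ℝ) / q) n = r • udir (T x) := by
    intro x
    rw [hnt₁, rot_smul, ← hut, rot_udir]
  have hiff : ∀ x : ZMod q, WTop c (rot (2 * π * (x.val : ℝ) / q) n) (u - 2 * x) ↔ WTop c (udir (T x)) (u - 2 * x) := by
    intro x; rw [hrot x, wTop_smul_iff c hr]
  have hTge : ∀ x : ZMod q, ω q ≤ T x := fun x => by
    have : (0 : ℝ) ≤ 2 * π * (x.val : ℝ) / q := by positivity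
    simp only [hT]; linarith
  have hTlt : ∀ x x' : ZMod q, T x' < T x + 2 * π := fun x x' => by
    have h1 : (x'.val : ℝ) < q := by exact_mod_cast ZMod.val_lt x'
    have h2 : (0 : ℝ) ≤ x.val := by positivity
    simp only [hT]
    have : 2 * π * (x'.val : ℝ) / q < 2 * π := by
      rw [div_lt_iff₀ hqpos]; nlinarith [Real.pi_pos]
    have : (0 : ℝ) ≤ 2 * π * (x.val : ℝ) / q := by positivity
    linarith
  have hTmono : ∀ x x' : ZMod q, x.val < x'.val → T x < T x' := fun x x' h => by
    have h1 : (x.val : ℝ) < x'.val := by exact_mod_cast h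
    simp only [hT]
    have : 2 * π * (x.val : ℝ) / q < 2 * π * (x'.val : ℝ) / q := by
      apply div_lt_div_of_pos_right _ hqpos; nlinarith [Real.pi_pos]
    linarith
  -- the lifts of the hits
  set H := Finset.univ.filter fun x : ZMod q => WTop c (rot (2 * π * (x.val : ℝ) / q) n) (u - 2 * x) with hH
  have hex : ∀ x, x ∈ H → ∃ i : ℕ, q ≤ i ∧ (i : ZMod q) = u - 2 * x ∧ ω (i - 1) ≤ T x ∧ T x ≤ ω i := by
    intro x hx
    have hw := (Finset.mem_filter.1 hx).2
    rw [hiff] at hw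
    exact hlift (T x) (u - 2 * x) (hTge x) hw
  choose! I hI using hex
  -- D x = I x + 2 val x is constant mod q on hits
  have hD : ∀ x ∈ H, ((I x + 2 * x.val : ℕ) : ZMod q) = u := by
    intro x hx
    obtain ⟨-, hIx, -, -⟩ := hI x hx
    push_cast; rw [hIx, ZMod.natCast_zmod_val]; ring
  -- comparison of two hits
  have hcmp : ∀ x ∈ H, ∀ x' ∈ H, x.val < x'.val →
      I x + 2 * x.val < I x' + 2 * x'.val ∧ I x' + 2 * x'.val < I x + 2 * x.val + 3 * q := by
    intro x hx x' hx' hlt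
    obtain ⟨hqI, -, hI1, hI2⟩ := hI x hx
    obtain ⟨hqI', -, hI1', hI2'⟩ := hI x' hx'
    have hTT := hTmono x x' hlt
    -- I x ≤ I x'
    have h1 : I x - 1 < I x' := by
      have : ω (I x - 1) < ω (I x') := lt_of_le_of_lt hI1 (lt_of_lt_of_le hTT hI2')
      exact hmono.lt_iff_lt.1 this
    -- I x' ≤ I x + q
    have h2 : I x' - 1 < I x + q := by
      have : ω (I x' - 1) < ω (I x + q) := by
        rw [hper]; exact lt_of_le_of_lt hI1' (lt_of_lt_of_le (hTlt x x') (by linarith))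
      exact hmono.lt_iff_lt.1 this
    have hxq : x'.val < q := ZMod.val_lt x'
    constructor <;> omega
  -- the injection into residues mod 3
  have hinj : Set.InjOn (fun x => ((I x + 2 * x.val) / q) % 3) H := by
    intro x hx x' hx' hxx'
    simp only [Finset.mem_coe] at hx hx'
    by_contra hne
    have hval : x.val ≠ x'.val := fun h => hne (ZMod.val_injective q h)
    -- the residues mod q agree
    have hmod : (I x + 2 * x.val) % q = (I x' + 2 * x'.val) % q := by
      have := (hD x hx).trans (hD x' hx').symm
      exact (ZMod.natCast_eq_natCast_iff' _ _ _).1 this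
    have key : ∀ D D' : ℕ, D % q = D' % q → D < D' → D' < D + 3 * q → (D / q) % 3 ≠ (D' / q) % 3 := by
      intro D D' hm hlt hlt'
      have e1 := Nat.div_add_mod D q
      have e2 := Nat.div_add_mod D' q
      set A := D / q
      set A' := D' / q
      have hA : A < A' := by
        by_contra hle
        push Not at hle
        have : q * A' ≤ q * A := Nat.mul_le_mul_left q hle
        omega
      have hA' : A' < A + 3 := by
        by_contra hle
        push Not at hle
        have : q * (A + 3) ≤ q * A' := Nat.mul_le_mul_left q hle
        have : q * (A + 3) = q * A + 3 * q := by ring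
        omega
      omega
    rcases lt_or_gt_of_ne hval with hlt | hgt
    · obtain ⟨c1, c2⟩ := hcmp x hx x' hx' hlt
      exact key _ _ hmod c1 c2 hxx'
    · obtain ⟨c1, c2⟩ := hcmp x' hx' x hx hgt
      exact key _ _ hmod.symm c1 c2 hxx'.symm
  have hmaps : ∀ x ∈ H, (fun x => ((I x + 2 * x.val) / q) % 3) x ∈ Finset.range 3 := fun x _ =>
    Finset.mem_range.2 (Nat.mod_lt _ (by norm_num))
  calc H.card ≤ (Finset.range 3).card := Finset.card_le_card_of_injOn _ hmaps hinj
    _ = 3 := Finset.card_range 3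

open scoped Classical in
/-- **`#{CommonDir} ≤ 4q` for a rigid pair and ANY strictly convex ccw third polygon** (`B² < A²`, `q ≥ 3`). [folklore] -/
theorem card_commonDir_rigid_le (hq : 3 ≤ q) {c : ZMod q → (Fin 2 → ℝ)} (hc : StrictlyConvexCcw c) (c₁ c₂ : Fin 2 → ℝ)
    {A B : ℝ} (hAB : B ^ 2 < A ^ 2) (φ ψ : ℝ) (s : ZMod q) :
    (Finset.univ.filter fun zx : ZMod q × ZMod q =>
      CommonDir (trigCurve c₁ A φ) (trigCurve c₂ B ψ) c s zx.1 zx.2).card ≤ 4 * q := by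
  set a := trigCurve (q := q) c₁ A φ with ha
  set b := trigCurve (q := q) c₂ B ψ with hb
  have hPconv : ∀ z, StrictlyConvexCcw (bpt a b s z) := fun z => strictlyConvexCcw_bpt_trigCurve hq c₁ c₂ hAB φ ψ s z
  have hP : ∀ z, SharpTops (bpt a b s z) := fun z => sharpTops_of_strictlyConvexCcw (hPconv z) hq
  have hab : RigidPair a b (c₁ + c₂) := rigidPair_trigCurve c₁ c₂ A B φ ψ
  have h01 : ∀ u, bpt a b s u 1 ≠ bpt a b s u 0 := fun u => by
    have := (hPconv u).succ_ne hq 0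
    rwa [zero_add] at this
  -- per `u`: all exposing weights are one direction, then the crossing number
  have hper_u : ∀ u : ZMod q, (Finset.univ.filter fun x : ZMod q => ∃ θ : Fin 2 → ℝ, θ ≠ 0 ∧
      WTop c (rot (2 * π * (x.val : ℝ) / q) θ) (u - 2 * x) ∧ WTop (bpt a b s u) θ 0 ∧ WTop (bpt a b s u) θ 1).card ≤ 3 := by
    intro u
    by_cases hex : ∃ θ₀ : Fin 2 → ℝ, θ₀ ≠ 0 ∧ WTop (bpt a b s u) θ₀ 0 ∧ WTop (bpt a b s u) θ₀ 1
    · obtain ⟨θ₀, hθ₀, h0, h1⟩ := hex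
      refine le_trans (Finset.card_le_card fun x hx => ?_) (card_rot_hits_le_three hc hq hθ₀ u)
      simp only [Finset.mem_filter, Finset.mem_univ, true_and] at hx ⊢
      obtain ⟨θ, hθ, hz, hx0, hx1⟩ := hx
      obtain ⟨t, ht, rfl⟩ := exposing_unique (hP u) hq (h01 u) hθ₀ hθ h0 h1 hx0 hx1
      rwa [rot_smul, wTop_smul_iff c ht] at hz
    · refine le_trans (le_of_eq ?_) (Nat.zero_le 3)
      rw [Finset.card_eq_zero, Finset.filter_eq_empty_iff]
      rintro x - ⟨θ, hθ, -, h0, h1⟩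
      exact hex ⟨θ, hθ, h0, h1⟩
  have h3 : (Finset.univ.filter fun ux : ZMod q × ZMod q => ∃ θ : Fin 2 → ℝ, θ ≠ 0 ∧
      WTop c (rot (2 * π * (ux.2.val : ℝ) / q) θ) (ux.1 - 2 * ux.2) ∧ WTop (bpt a b s ux.1) θ 0 ∧ WTop (bpt a b s ux.1) θ 1).card
      ≤ 3 * q := by
    rw [card_filter_prod_eq_sum]
    calc ∑ u : ZMod q, _ ≤ ∑ u : ZMod q, 3 := Finset.sum_le_sum fun u _ => hper_u u
      _ = 3 * q := by rw [Finset.sum_const, Finset.card_univ, ZMod.card, smul_eq_mul, mul_comm]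
  calc (Finset.univ.filter fun zx : ZMod q × ZMod q => CommonDir a b c s zx.1 zx.2).card
      ≤ q + (Finset.univ.filter fun zx : ZMod q × ZMod q => EdgeHit a b c s zx.1 zx.2).card :=
        card_commonDir_le_add a b hc hq s hP
    _ ≤ q + 3 * q := by rw [card_edgeHit_eq_of_rigid hab c s]; exact Nat.add_le_add_left h3 q
    _ = 4 * q := by ring

/-- **THE CO-ORIENTED POINTWISE LAW FOR RIGID PAIRS, one class**: `a, b` sampled circles with `A² ≠ B²`, `c` ANY strictly convex ccw
polygon, `q ≥ 3`: for every class `s` there is `μ₀` with `V_s(a, b, μ•c) ≤ 4q` for all `μ ≥ μ₀`. [folklore] -/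
theorem classVert_rigid_smul_le_of_class (hq : 3 ≤ q) {c : ZMod q → (Fin 2 → ℝ)} (hc : StrictlyConvexCcw c)
    (c₁ c₂ : Fin 2 → ℝ) {A B : ℝ} (hAB : A ^ 2 ≠ B ^ 2) (φ ψ : ℝ) (s : ZMod q) :
    ∃ μ₀ : ℝ, ∀ μ : ℝ, μ₀ ≤ μ → classVert (trigCurve c₁ A φ) (trigCurve c₂ B ψ) (μ • c) s ≤ 4 * q := by
  classical
  rcases lt_or_gt_of_ne hAB with hlt | hgt
  · obtain ⟨μ₀, hμ₀⟩ := classVert_smul_le_card_commonDir (trigCurve (q := q) c₂ B ψ) (trigCurve c₁ A φ) c s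
    refine ⟨μ₀, fun μ hμ => ?_⟩
    rw [classVert_swap]
    exact (hμ₀ μ hμ).trans (card_commonDir_rigid_le hq hc c₂ c₁ hlt ψ φ s)
  · obtain ⟨μ₀, hμ₀⟩ := classVert_smul_le_card_commonDir (trigCurve (q := q) c₁ A φ) (trigCurve c₂ B ψ) c s
    exact ⟨μ₀, fun μ hμ => (hμ₀ μ hμ).trans (card_commonDir_rigid_le hq hc c₁ c₂ hgt φ ψ s)⟩

/-- **THE CO-ORIENTED POINTWISE LAW FOR RIGID PAIRS** (dominant regime, all classes): `∃ μ₀, ∀ μ ≥ μ₀, ∀ s, V_s(a, b, μ•c) ≤ 4q` for two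
sampled circles (`A² ≠ B²`) and ANY strictly convex counter-clockwise third polygon — the positive half of the orientation dichotomy of
NOTES-t1g8 §2 (contrast `…SmoothPointwise`: a clockwise fan gives a class with `≥ q²/2` vertices). [folklore] -/
theorem classVert_rigid_smul_le (hq : 3 ≤ q) {c : ZMod q → (Fin 2 → ℝ)} (hc : StrictlyConvexCcw c) (c₁ c₂ : Fin 2 → ℝ)
    {A B : ℝ} (hAB : A ^ 2 ≠ B ^ 2) (φ ψ : ℝ) :
    ∃ μ₀ : ℝ, ∀ μ : ℝ, μ₀ ≤ μ → ∀ s : ZMod q, classVert (trigCurve c₁ A φ) (trigCurve c₂ B ψ) (μ • c) s ≤ 4 * q := by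
  choose f hf using fun s => classVert_rigid_smul_le_of_class hq hc c₁ c₂ hAB φ ψ s
  refine ⟨Finset.univ.sup' Finset.univ_nonempty f, fun μ hμ s => hf s μ ?_⟩
  exact (Finset.le_sup' f (Finset.mem_univ s)).trans hμ

/-- **Totals form**: `T(a, b, μ•c) ≤ 4q²` for a rigid pair and any strictly convex ccw third polygon, `μ ≥ μ₀`. [folklore] -/
theorem totalVert_rigid_smul_le (hq : 3 ≤ q) {c : ZMod q → (Fin 2 → ℝ)} (hc : StrictlyConvexCcw c) (c₁ c₂ : Fin 2 → ℝ)
    {A B : ℝ} (hAB : A ^ 2 ≠ B ^ 2) (φ ψ : ℝ) :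
    ∃ μ₀ : ℝ, ∀ μ : ℝ, μ₀ ≤ μ → totalVert (trigCurve (q := q) c₁ A φ) (trigCurve c₂ B ψ) (μ • c) ≤ 4 * q ^ 2 := by
  obtain ⟨μ₀, hμ₀⟩ := classVert_rigid_smul_le hq hc c₁ c₂ hAB φ ψ
  refine ⟨μ₀, fun μ hμ => ?_⟩
  unfold totalVert
  calc ∑ s, classVert (trigCurve (q := q) c₁ A φ) (trigCurve c₂ B ψ) (μ • c) s ≤ ∑ _s : ZMod q, 4 * q :=
        Finset.sum_le_sum fun s _ => hμ₀ μ hμ s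
    _ = 4 * q ^ 2 := by rw [Finset.sum_const, Finset.card_univ, ZMod.card, smul_eq_mul]; ring

end CoOrientedRigid

end TotalsLaw

end Summit.ValiantsHypothesis.ValiantsHypothesis.Theorems.NewtonUnitEquationsDissociatedUniform
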